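import Mathlib
import HarnessLib

/-!
# Route `KLProgramme` — crux C4a, S3 brick (B4): the CAUSTIC TRANSPORT OPERATOR `T_q w = ∂_θ w − ∂_ϑ(q·w)` (definition file for `…C4aCausticTransport[Iterated]`)

Cell `gate-hubbard-kl`, seat hubbard-kl-k3c3-p3 (g39; row «implicit-function / monotonicity route for μ(n)»).  Located brick for the (C)-closer lane (stub (C) `stub_twoLeg_curvature`
of `KLRegimeEngineV17F2`, stmt-HubbardSuperconductivity-20437), memo HOME/hubbard-kl-k3c3-p3/K2-FIRST-STEP.md §4 (γ); pen (R559): architecture word (γ) = the SIGNED first-scales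
tube theorem.  `…C4aCausticTransport.hasDerivAt_intervalIntegral_smul_comp_transport` differentiates `θ ↦ ∫_a^b w(θ,ϑ)•g(d(θ,ϑ)) dϑ` by transporting `∂_θ` onto the window
weight; the derivative is `∫ (T_q w)(θ,ϑ)•g(d(θ,ϑ)) dϑ` with
* `transportOp q w θ ϑ := deriv (fun t => w t ϑ) θ − deriv (fun s => q θ s * w θ s) ϑ` — the transpose of the vector field `∂_θ + q·∂_ϑ` along which `d` is constant.
Iterating (`…C4aCausticTransportIterated`) gives `∂_θᵏ ∫ w•g(d) = ∫ (T_qᵏ w)•g(d)`: no derivative ever lands on the cusp profile `g`.  Elementary facts here: unfolding; a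
one-sided vanishing lemma for `deriv`; **`transportOp_eq_zero_of_forall`** / **`iterate_transportOp_eq_zero_of_forall`** — if `w(θ,ϑ) = 0` for all `θ` and all `ϑ` off a
window `(a′,b′)`, the same holds for `T_q w` and all its iterates (the class the iteration runs in).
Carrier-free; Mathlib only; nothing is asserted about the Hubbard model.
References: FST II CPAM 51 (1998) §3 [cite: FeldmanSalmhoferTrubowitz1998]; BGM 2006 §2.4 [cite: BenfattoGiulianiMastropietro2006].
-/

noncomputable section

namespace Summit.HubbardSuperconductivity.HubbardSuperconductivity.Theorems.C4a

set_option linter.dupNamespace false -- summit = problem name (single-conjunct summit), D-0017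

open Real Set Filter
open scoped Topology

/-- **The caustic transport operator** `T_q w (θ,ϑ) = ∂_θ w(θ,ϑ) − ∂_ϑ (q(θ,·)·w(θ,·))(ϑ)`: the transpose (in `dϑ`) of the vector field `∂_θ + q·∂_ϑ`, along which a
transported level function `d` (`∂_θ d = q·∂_ϑ d`) is constant. -/
def transportOp (q w : ℝ → ℝ → ℝ) : ℝ → ℝ → ℝ := fun θ ϑ => deriv (fun t : ℝ => w t ϑ) θ - deriv (fun s : ℝ => q θ s * w θ s) ϑ

/-- Unfolding `transportOp`. -/
theorem transportOp_apply (q w : ℝ → ℝ → ℝ) (θ ϑ : ℝ) :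
    transportOp q w θ ϑ = deriv (fun t : ℝ => w t ϑ) θ - deriv (fun s : ℝ => q θ s * w θ s) ϑ := rfl

/-- A function vanishing on `(−∞, x]` has `deriv f x = 0` (one-sided uniqueness if differentiable, the junk value otherwise). [folklore] -/
theorem deriv_eq_zero_of_forall_le_eq_zero {f : ℝ → ℝ} {x : ℝ} (h : ∀ s ≤ x, f s = 0) : deriv f x = 0 := by
  by_cases hf : DifferentiableAt ℝ f x
  · have h1 : HasDerivWithinAt f (deriv f x) (Iic x) x := hf.hasDerivAt.hasDerivWithinAt
    have h2 : HasDerivWithinAt f 0 (Iic x) x :=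
      (hasDerivWithinAt_const x (Iic x) (0 : ℝ)).congr (fun s hs => h s hs) (h x le_rfl)
    exact (uniqueDiffOn_Iic x x self_mem_Iic).eq_deriv _ h1 h2
  · exact deriv_zero_of_not_differentiableAt hf

/-- A function vanishing on `[x, ∞)` has `deriv f x = 0`. [folklore] -/
theorem deriv_eq_zero_of_forall_ge_eq_zero {f : ℝ → ℝ} {x : ℝ} (h : ∀ s ≥ x, f s = 0) : deriv f x = 0 := by
  by_cases hf : DifferentiableAt ℝ f x
  · have h1 : HasDerivWithinAt f (deriv f x) (Ici x) x := hf.hasDerivAt.hasDerivWithinAt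
    have h2 : HasDerivWithinAt f 0 (Ici x) x :=
      (hasDerivWithinAt_const x (Ici x) (0 : ℝ)).congr (fun s hs => h s hs) (h x le_rfl)
    exact (uniqueDiffOn_Ici x x self_mem_Ici).eq_deriv _ h1 h2
  · exact deriv_zero_of_not_differentiableAt hf

/-- **`T_q w` vanishes off the window wherever `w` does, identically in `θ`**: `(∀ θ, ∀ ϑ ∉ (a′,b′), w θ ϑ = 0) ⟹ ∀ θ, ∀ ϑ ∉ (a′,b′), transportOp q w θ ϑ = 0`. -/
theorem transportOp_eq_zero_of_forall {q w : ℝ → ℝ → ℝ} {a' b' : ℝ} (hzero : ∀ θ, ∀ ϑ ∉ Ioo a' b', w θ ϑ = 0) (θ : ℝ) {ϑ : ℝ} (hϑ : ϑ ∉ Ioo a' b') :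
    transportOp q w θ ϑ = 0 := by
  rw [transportOp_apply]
  have h1 : (fun t : ℝ => w t ϑ) = fun _ => 0 := funext fun t => hzero t ϑ hϑ
  have h2 : deriv (fun s : ℝ => q θ s * w θ s) ϑ = 0 := by
    rcases not_and_or.1 (fun h : a' < ϑ ∧ ϑ < b' => hϑ h) with hle | hge
    · -- `ϑ ≤ a′`: the product vanishes on `(−∞, ϑ]`
      refine deriv_eq_zero_of_forall_le_eq_zero fun s hs => ?_
      rw [hzero θ s fun h => hle (lt_of_lt_of_le h.1 hs), mul_zero]
    · -- `b′ ≤ ϑ`: the product vanishes on `[ϑ, ∞)`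
      refine deriv_eq_zero_of_forall_ge_eq_zero fun s hs => ?_
      rw [hzero θ s fun h => hge (lt_of_le_of_lt hs h.2), mul_zero]
  rw [h1, deriv_const, h2, sub_zero]

/-- The iterates `T_qᵏ w` vanish off the window as well. -/
theorem iterate_transportOp_eq_zero_of_forall {q w : ℝ → ℝ → ℝ} {a' b' : ℝ} (hzero : ∀ θ, ∀ ϑ ∉ Ioo a' b', w θ ϑ = 0) (k : ℕ) (θ : ℝ) {ϑ : ℝ}
    (hϑ : ϑ ∉ Ioo a' b') : (transportOp q)^[k] w θ ϑ = 0 := by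
  induction k generalizing θ ϑ with
  | zero => exact hzero θ ϑ hϑ
  | succ k ih =>
    rw [Function.iterate_succ_apply']
    exact transportOp_eq_zero_of_forall (fun θ' ϑ' hϑ' => ih θ' hϑ') θ hϑ

/-- Off the window the iterate's `θ`-slice has `tsupport ⊆ [a′, b′]`. -/
theorem tsupport_iterate_transportOp_subset {q w : ℝ → ℝ → ℝ} {a' b' : ℝ} (hzero : ∀ θ, ∀ ϑ ∉ Ioo a' b', w θ ϑ = 0) (k : ℕ) (θ : ℝ) :
    tsupport ((transportOp q)^[k] w θ) ⊆ Icc a' b' := by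
  refine closure_minimal (fun ϑ hϑ => ?_) isClosed_Icc
  by_contra hnot
  exact hϑ (iterate_transportOp_eq_zero_of_forall hzero k θ fun h => hnot (Ioo_subset_Icc_self h))

end Summit.HubbardSuperconductivity.HubbardSuperconductivity.Theorems.C4a

end
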